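import Mathlib
import Summits.Ventures.PercRepro2.Defs
import Summits.Ventures.PercRepro2.Harris
import Summits.Ventures.PercRepro2.Graph
import Summits.Ventures.PercRepro2.Events
import Summits.Ventures.PercRepro2.Induced
import Summits.Ventures.PercRepro2.BHKEvents
import Summits.Ventures.PercRepro2.BHKAvoid

/-!
# Avoid-weighted positive association across the two clusters (blind cell PercRepro2, p2)

Conditionally on `Q = {s ↮ t}` write `ν` for the law of `K = C_s`, `β(K) = P_{G∖K}(b ↔ t)`
(the conditional probability of `b ∈ C_t` given `C_s = K`, antitone in `K`) and, for vertices
`u`, `o`, the events `U = {u ∈ C_s}`, `O = {o ∈ C_s}`.  The AVOID-WEIGHTED inequality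

  `E_ν[ 1_{Uᶜ} · (β − E_ν β) · (1_{Oᶜ} − ν(Oᶜ)) ] ≥ 0`

— the product of the two deviations, weighted by the avoidance `u ∉ C_s`, has nonnegative mean
— follows from three instances of van den Berg–Häggström–Kahn (2006): the cross-cluster
inequality with the avoid set `{t, u}` (`bhk_cross_cluster_avoid`: given `s ↮ {t, u}` the
antitone pair `(β, 1_{Oᶜ})` is positively correlated), and, under `s ↮ t`, the two lifts
`E[β | u ∉ C_s] ≥ E β` (`bhk_cross_cluster`) and `ν(o ∉ C_s | u ∉ C_s) ≥ ν(o ∉ C_s)`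
(`bhk_same_cluster_events`): by the law of total covariance the left side is
`ν(Uᶜ)·[Cov(β, 1_{Oᶜ} | Uᶜ) + (E[β | Uᶜ] − Eβ)(ν(Oᶜ | Uᶜ) − ν(Oᶜ))]`, a nonnegative
covariance plus a product of two nonnegative lifts.

Multiplied out (`r = P(Q)`, `r_u = P(s ↮ {t, u})`, `X = P(b ∈ C_t, Q)`, `x = P(b ∈ C_t, s ↮ {t,u})`,
`Y = P(o ∉ C_s, Q)`, `y = P(o ∉ C_s, s ↮ {t,u})`, `z = P(b ∈ C_t, o ∉ C_s, s ↮ {t,u})`):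

  `Y·x·r + X·y·r ≤ z·r² + X·Y·r_u`   (`bhk_avoid_weighted`),

proved from `z·r_u ≥ x·y`, `r·x ≥ r_u·X`, `r·y ≥ r_u·Y` through the identity
`(z·r² − Y·x·r − X·y·r + X·Y·r_u)·r_u = (z·r_u − x·y)·r² + (r·x − r_u·X)(r·y − r_u·Y)`.

Equivalently, in the covariance language of the cell's row 2′BETA1 line
(proofs/P2-G14-PAIRSPLIT.md, the «same-side» half (I6) of the pair form):
`Cov_μ(1[b ∈ C_t], 1[o ∈ C_s, u ∉ C_s] + μ(o ∈ C_s)·1[u ∈ C_s]) ≤ 0` under `μ = P(· | Q)`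
(`sameSide_drop`).
-/

namespace Summit.Ventures.PercRepro2

section AvoidWeighted

variable {V : Type*} {E : Type*} [Fintype E] [DecidableEq E] [Fintype V] [DecidableEq V]
  {R : Type*} [CommRing R] [LinearOrder R] [IsStrictOrderedRing R]

omit [Fintype E] [DecidableEq E] [Fintype V] [DecidableEq V] in
/-- `{W | v ∈ W}` is an up-set of vertex sets. -/
lemma isUpperSet_memFamily (v : V) : IsUpperSet {W : Set V | v ∈ W} :=
  fun _ _ h hv => h hv

omit [Fintype E] [DecidableEq E] [Fintype V] [DecidableEq V] in
/-- `{u ∈ C_s} = {s ↔ u}`. -/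
lemma clusterInEvent_memFamily_eq_connEvent (ends : E → Sym2 V) (s u : V) :
    clusterInEvent ends s {W : Set V | u ∈ W} = connEvent ends s u := by
  ext ω
  simp only [mem_clusterInEvent, Set.mem_setOf_eq, mem_cluster, mem_connEvent]

omit [Fintype E] [DecidableEq E] [Fintype V] in
/-- `{s ↮ {t, u}} = {s ↮ t} ∩ {s ↮ u}`. -/
lemma avoidAll_pair (ends : E → Sym2 V) (s t u : V) :
    avoidAll ends s {t, u} = (connEvent ends s t)ᶜ ∩ (connEvent ends s u)ᶜ := by
  ext ω
  simp only [mem_avoidAll, Finset.mem_insert, Finset.mem_singleton, Set.mem_inter_iff,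
    Set.mem_compl_iff, mem_connEvent]
  constructor
  · intro h
    exact ⟨h t (Or.inl rfl), h u (Or.inr rfl)⟩
  · rintro ⟨h1, h2⟩ x hx
    rcases hx with rfl | rfl
    · exact h1
    · exact h2

/-- The algebra behind `bhk_avoid_weighted`, over any linearly ordered commutative ring: from the
three BHK instances `ob·ru ≤ oU·x`, `ub·r ≤ uR·X`, `oR·uR ≤ ou·r` and the splits
`x = ob + z`, `ru = oU + y`, `X = ub + x`, `r = uR + ru`, `oR = ou + oU`, `r = oR + Y`,
`Y·x·r + X·y·r ≤ z·r² + X·Y·ru`. -/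
lemma avoid_weighted_algebra {r ru X x Y y z oR oU ob uR ub ou : R}
    (hr0 : 0 ≤ r) (hru0 : 0 ≤ ru) (hx0 : 0 ≤ x) (hy0 : 0 ≤ y) (hz0 : 0 ≤ z)
    (hxru : x ≤ ru) (hyru : y ≤ ru)
    (sa : x = ob + z) (sb : ru = oU + y) (sc : X = ub + x) (sd : r = uR + ru)
    (se : oR = ou + oU) (sf : r = oR + Y)
    (hi : ob * ru ≤ oU * x) (hii : ub * r ≤ uR * X) (hiii : oR * uR ≤ ou * r) :
    Y * x * r + X * y * r ≤ z * r * r + X * Y * ru := by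
  have hi' : x * y ≤ z * ru := by
    have e : z * ru - x * y = oU * x - ob * ru := by
      rw [show z = x - ob by linarith, show y = ru - oU by linarith]; ring
    linarith
  have hii' : ru * X ≤ r * x := by
    have e : r * x - ru * X = uR * X - ub * r := by
      rw [show x = X - ub by linarith, show ru = r - uR by linarith]; ring
    linarith
  have hiii' : ru * Y ≤ r * y := by
    have e : r * y - ru * Y = ou * r - oR * uR := by
      rw [show y = ru - oU by linarith, show oU = oR - ou by linarith,
        show Y = r - oR by linarith, show ru = r - uR by linarith]; ring
    linarith
  have hprod : 0 ≤ (r * x - ru * X) * (r * y - ru * Y) :=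
    mul_nonneg (by linarith) (by linarith)
  have hkey : (z * r * r + X * Y * ru - (Y * x * r + X * y * r)) * ru =
      (z * ru - x * y) * (r * r) + (r * x - ru * X) * (r * y - ru * Y) := by ring
  suffices hT : 0 ≤ z * r * r + X * Y * ru - (Y * x * r + X * y * r) by linarith
  rcases hru0.lt_or_eq with hpos | hzero
  · have hTru : 0 ≤ (z * r * r + X * Y * ru - (Y * x * r + X * y * r)) * ru := by
      rw [hkey]
      exact add_nonneg (mul_nonneg (by linarith) (mul_nonneg hr0 hr0)) hprod
    exact nonneg_of_mul_nonneg_left hTru hpos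
  · have hx' : x = 0 := le_antisymm (hzero ▸ hxru) hx0
    have hy' : y = 0 := le_antisymm (hzero ▸ hyru) hy0
    rw [hx', hy', ← hzero]
    have := mul_nonneg hz0 (mul_nonneg hr0 hr0)
    nlinarith

/-- **Avoid-weighted positive association** (multiplied out): with `Q = {s ↮ t}`,
`Q_u = {s ↮ t} ∩ {s ↮ u}`, `B = {b ∈ C_t}`, `Oᶜ = {o ∉ C_s}`,

  `P(Oᶜ, Q)·P(B, Q_u)·P(Q) + P(B, Q)·P(Oᶜ, Q_u)·P(Q) ≤ P(B, Oᶜ, Q_u)·P(Q)² + P(B, Q)·P(Oᶜ, Q)·P(Q_u)`,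

i.e. `E_ν[1_{Uᶜ}(β − Eβ)(1_{Oᶜ} − ν(Oᶜ))] ≥ 0` for the law `ν` of `C_s` given `Q`. -/
theorem bhk_avoid_weighted (p : E → R) (hp : IsProbVec p) (ends : E → Sym2 V) (s t u o b : V) :
    prob p ((clusterInEvent ends s {W : Set V | o ∈ W})ᶜ ∩ (connEvent ends s t)ᶜ) *
          prob p (clusterInEvent ends t {W : Set V | b ∈ W} ∩
            ((connEvent ends s t)ᶜ ∩ (connEvent ends s u)ᶜ)) *
          prob p (connEvent ends s t)ᶜ +
        prob p (clusterInEvent ends t {W : Set V | b ∈ W} ∩ (connEvent ends s t)ᶜ) *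
          prob p ((clusterInEvent ends s {W : Set V | o ∈ W})ᶜ ∩
            ((connEvent ends s t)ᶜ ∩ (connEvent ends s u)ᶜ)) *
          prob p (connEvent ends s t)ᶜ ≤
      prob p (clusterInEvent ends t {W : Set V | b ∈ W} ∩
            (clusterInEvent ends s {W : Set V | o ∈ W})ᶜ ∩
            ((connEvent ends s t)ᶜ ∩ (connEvent ends s u)ᶜ)) *
          prob p (connEvent ends s t)ᶜ * prob p (connEvent ends s t)ᶜ +
        prob p (clusterInEvent ends t {W : Set V | b ∈ W} ∩ (connEvent ends s t)ᶜ) *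
          prob p ((clusterInEvent ends s {W : Set V | o ∈ W})ᶜ ∩ (connEvent ends s t)ᶜ) *
          prob p ((connEvent ends s t)ᶜ ∩ (connEvent ends s u)ᶜ) := by
  classical
  have hU : clusterInEvent ends s {W : Set V | u ∈ W} = connEvent ends s u :=
    clusterInEvent_memFamily_eq_connEvent ends s u
  -- the three BHK instances
  have hi := bhk_cross_cluster_avoid p hp ends s t (X := {t, u}) (by simp)
    (isUpperSet_memFamily o) (isUpperSet_memFamily b)
  rw [avoidAll_pair] at hi
  have hii := bhk_cross_cluster p hp ends s t (isUpperSet_memFamily u) (isUpperSet_memFamily b)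
  rw [hU] at hii
  have hiii := bhk_same_cluster_events p hp ends s t (isUpperSet_memFamily o)
    (isUpperSet_memFamily u)
  rw [hU] at hiii
  -- the splits (law of total probability), in the shapes of the masses
  have sa := prob_inter_add_prob_inter_compl p
    (clusterInEvent ends t {W : Set V | b ∈ W} ∩ ((connEvent ends s t)ᶜ ∩ (connEvent ends s u)ᶜ))
    (clusterInEvent ends s {W : Set V | o ∈ W})
  have ea1 : clusterInEvent ends t {W : Set V | b ∈ W} ∩
      ((connEvent ends s t)ᶜ ∩ (connEvent ends s u)ᶜ) ∩ clusterInEvent ends s {W : Set V | o ∈ W} =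
      clusterInEvent ends s {W : Set V | o ∈ W} ∩ clusterInEvent ends t {W : Set V | b ∈ W} ∩
      ((connEvent ends s t)ᶜ ∩ (connEvent ends s u)ᶜ) := by
    ext ω; simp only [Set.mem_inter_iff]; tauto
  have ea2 : clusterInEvent ends t {W : Set V | b ∈ W} ∩
      ((connEvent ends s t)ᶜ ∩ (connEvent ends s u)ᶜ) ∩
      (clusterInEvent ends s {W : Set V | o ∈ W})ᶜ =
      clusterInEvent ends t {W : Set V | b ∈ W} ∩ (clusterInEvent ends s {W : Set V | o ∈ W})ᶜ ∩
      ((connEvent ends s t)ᶜ ∩ (connEvent ends s u)ᶜ) := by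
    ext ω; simp only [Set.mem_inter_iff, Set.mem_compl_iff]; tauto
  rw [ea1, ea2] at sa
  have sb := prob_inter_add_prob_inter_compl p ((connEvent ends s t)ᶜ ∩ (connEvent ends s u)ᶜ)
    (clusterInEvent ends s {W : Set V | o ∈ W})
  have eb1 : (connEvent ends s t)ᶜ ∩ (connEvent ends s u)ᶜ ∩
      clusterInEvent ends s {W : Set V | o ∈ W} =
      clusterInEvent ends s {W : Set V | o ∈ W} ∩ ((connEvent ends s t)ᶜ ∩ (connEvent ends s u)ᶜ) :=
    Set.inter_comm _ _
  have eb2 : (connEvent ends s t)ᶜ ∩ (connEvent ends s u)ᶜ ∩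
      (clusterInEvent ends s {W : Set V | o ∈ W})ᶜ =
      (clusterInEvent ends s {W : Set V | o ∈ W})ᶜ ∩
      ((connEvent ends s t)ᶜ ∩ (connEvent ends s u)ᶜ) :=
    Set.inter_comm _ _
  rw [eb1, eb2] at sb
  have sc := prob_inter_add_prob_inter_compl p
    (clusterInEvent ends t {W : Set V | b ∈ W} ∩ (connEvent ends s t)ᶜ) (connEvent ends s u)
  have ec1 : clusterInEvent ends t {W : Set V | b ∈ W} ∩ (connEvent ends s t)ᶜ ∩
      connEvent ends s u =
      connEvent ends s u ∩ clusterInEvent ends t {W : Set V | b ∈ W} ∩ (connEvent ends s t)ᶜ := by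
    ext ω; simp only [Set.mem_inter_iff]; tauto
  have ec2 : clusterInEvent ends t {W : Set V | b ∈ W} ∩ (connEvent ends s t)ᶜ ∩
      (connEvent ends s u)ᶜ =
      clusterInEvent ends t {W : Set V | b ∈ W} ∩
      ((connEvent ends s t)ᶜ ∩ (connEvent ends s u)ᶜ) :=
    Set.inter_assoc _ _ _
  rw [ec1, ec2] at sc
  have sd := prob_inter_add_prob_inter_compl p (connEvent ends s t)ᶜ (connEvent ends s u)
  have ed1 : (connEvent ends s t)ᶜ ∩ connEvent ends s u =
      connEvent ends s u ∩ (connEvent ends s t)ᶜ := Set.inter_comm _ _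
  rw [ed1] at sd
  have se := prob_inter_add_prob_inter_compl p
    (clusterInEvent ends s {W : Set V | o ∈ W} ∩ (connEvent ends s t)ᶜ) (connEvent ends s u)
  have ee1 : clusterInEvent ends s {W : Set V | o ∈ W} ∩ (connEvent ends s t)ᶜ ∩
      connEvent ends s u =
      clusterInEvent ends s {W : Set V | o ∈ W} ∩ connEvent ends s u ∩ (connEvent ends s t)ᶜ := by
    ext ω; simp only [Set.mem_inter_iff]; tauto
  have ee2 : clusterInEvent ends s {W : Set V | o ∈ W} ∩ (connEvent ends s t)ᶜ ∩
      (connEvent ends s u)ᶜ =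
      clusterInEvent ends s {W : Set V | o ∈ W} ∩
      ((connEvent ends s t)ᶜ ∩ (connEvent ends s u)ᶜ) :=
    Set.inter_assoc _ _ _
  rw [ee1, ee2] at se
  have sf := prob_inter_add_prob_inter_compl p (connEvent ends s t)ᶜ
    (clusterInEvent ends s {W : Set V | o ∈ W})
  have ef1 : (connEvent ends s t)ᶜ ∩ clusterInEvent ends s {W : Set V | o ∈ W} =
      clusterInEvent ends s {W : Set V | o ∈ W} ∩ (connEvent ends s t)ᶜ := Set.inter_comm _ _
  have ef2 : (connEvent ends s t)ᶜ ∩ (clusterInEvent ends s {W : Set V | o ∈ W})ᶜ =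
      (clusterInEvent ends s {W : Set V | o ∈ W})ᶜ ∩ (connEvent ends s t)ᶜ := Set.inter_comm _ _
  rw [ef1, ef2] at sf
  -- assemble
  exact avoid_weighted_algebra (prob_nonneg hp _) (prob_nonneg hp _) (prob_nonneg hp _)
    (prob_nonneg hp _) (prob_nonneg hp _) (prob_mono hp Set.inter_subset_right)
    (prob_mono hp Set.inter_subset_right) sa.symm sb.symm sc.symm sd.symm se.symm sf.symm
    hi hii hiii

/-- The linear bookkeeping behind `sameSide_drop`: the same-side inequality is the
avoid-weighted one after the splits. -/
lemma sameSide_drop_algebra {r ru X x Y y z oR oU ob uR ub : R}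
    (sa : x = ob + z) (sb : ru = oU + y) (sc : X = ub + x) (sd : r = uR + ru) (sf : r = oR + Y)
    (h : Y * x * r + X * y * r ≤ z * r * r + X * Y * ru) :
    ob * r * r + oR * ub * r ≤ X * (oU * r + oR * uR) := by
  have hob : ob = x - z := by linarith
  have hub : ub = X - x := by linarith
  have hoU : oU = ru - y := by linarith
  have huR : uR = r - ru := by linarith
  have hoR : oR = r - Y := by linarith
  rw [hob, hub, hoU, huR, hoR]
  have e : (x - z) * r * r + (r - Y) * (X - x) * r - X * ((ru - y) * r + (r - Y) * (r - ru)) =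
      -(z * r * r + X * Y * ru - (Y * x * r + X * y * r)) := by ring
  linarith

/-- **The same-side drop inequality** (the half (I6) of the pair form of row 2′BETA1): with
`Q = {s ↮ t}`, `Q_u = Q ∩ {s ↮ u}`, `B = {b ∈ C_t}`, `O = {o ∈ C_s}`, `U = {s ↔ u}`,

  `P(O, B, Q_u)·P(Q)² + P(O, Q)·P(U, B, Q)·P(Q) ≤ P(B, Q)·(P(O, Q_u)·P(Q) + P(O, Q)·P(U, Q))`,

i.e. `Cov_μ(1_B, 1_O·1_{Uᶜ} + μ(O)·1_U) ≤ 0` under `μ = P(· | Q)`: conditioning on `b ∈ C_t`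
lowers the probability of `{o ∈ C_s, u ∉ C_s}` by at least `μ(o ∈ C_s)` times the drop of
`{u ∈ C_s}`. -/
theorem sameSide_drop (p : E → R) (hp : IsProbVec p) (ends : E → Sym2 V) (s t u o b : V) :
    prob p (clusterInEvent ends s {W : Set V | o ∈ W} ∩ clusterInEvent ends t {W : Set V | b ∈ W} ∩
          ((connEvent ends s t)ᶜ ∩ (connEvent ends s u)ᶜ)) *
          prob p (connEvent ends s t)ᶜ * prob p (connEvent ends s t)ᶜ +
        prob p (clusterInEvent ends s {W : Set V | o ∈ W} ∩ (connEvent ends s t)ᶜ) *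
          prob p (connEvent ends s u ∩ clusterInEvent ends t {W : Set V | b ∈ W} ∩
            (connEvent ends s t)ᶜ) *
          prob p (connEvent ends s t)ᶜ ≤
      prob p (clusterInEvent ends t {W : Set V | b ∈ W} ∩ (connEvent ends s t)ᶜ) *
        (prob p (clusterInEvent ends s {W : Set V | o ∈ W} ∩
            ((connEvent ends s t)ᶜ ∩ (connEvent ends s u)ᶜ)) *
            prob p (connEvent ends s t)ᶜ +
          prob p (clusterInEvent ends s {W : Set V | o ∈ W} ∩ (connEvent ends s t)ᶜ) *
            prob p (connEvent ends s u ∩ (connEvent ends s t)ᶜ)) := by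
  classical
  have main := bhk_avoid_weighted p hp ends s t u o b
  have sa := prob_inter_add_prob_inter_compl p
    (clusterInEvent ends t {W : Set V | b ∈ W} ∩ ((connEvent ends s t)ᶜ ∩ (connEvent ends s u)ᶜ))
    (clusterInEvent ends s {W : Set V | o ∈ W})
  have ea1 : clusterInEvent ends t {W : Set V | b ∈ W} ∩
      ((connEvent ends s t)ᶜ ∩ (connEvent ends s u)ᶜ) ∩ clusterInEvent ends s {W : Set V | o ∈ W} =
      clusterInEvent ends s {W : Set V | o ∈ W} ∩ clusterInEvent ends t {W : Set V | b ∈ W} ∩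
      ((connEvent ends s t)ᶜ ∩ (connEvent ends s u)ᶜ) := by
    ext ω; simp only [Set.mem_inter_iff]; tauto
  have ea2 : clusterInEvent ends t {W : Set V | b ∈ W} ∩
      ((connEvent ends s t)ᶜ ∩ (connEvent ends s u)ᶜ) ∩
      (clusterInEvent ends s {W : Set V | o ∈ W})ᶜ =
      clusterInEvent ends t {W : Set V | b ∈ W} ∩ (clusterInEvent ends s {W : Set V | o ∈ W})ᶜ ∩
      ((connEvent ends s t)ᶜ ∩ (connEvent ends s u)ᶜ) := by
    ext ω; simp only [Set.mem_inter_iff, Set.mem_compl_iff]; tauto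
  rw [ea1, ea2] at sa
  have sb := prob_inter_add_prob_inter_compl p ((connEvent ends s t)ᶜ ∩ (connEvent ends s u)ᶜ)
    (clusterInEvent ends s {W : Set V | o ∈ W})
  have eb1 : (connEvent ends s t)ᶜ ∩ (connEvent ends s u)ᶜ ∩
      clusterInEvent ends s {W : Set V | o ∈ W} =
      clusterInEvent ends s {W : Set V | o ∈ W} ∩ ((connEvent ends s t)ᶜ ∩ (connEvent ends s u)ᶜ) :=
    Set.inter_comm _ _
  have eb2 : (connEvent ends s t)ᶜ ∩ (connEvent ends s u)ᶜ ∩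
      (clusterInEvent ends s {W : Set V | o ∈ W})ᶜ =
      (clusterInEvent ends s {W : Set V | o ∈ W})ᶜ ∩
      ((connEvent ends s t)ᶜ ∩ (connEvent ends s u)ᶜ) :=
    Set.inter_comm _ _
  rw [eb1, eb2] at sb
  have sc := prob_inter_add_prob_inter_compl p
    (clusterInEvent ends t {W : Set V | b ∈ W} ∩ (connEvent ends s t)ᶜ) (connEvent ends s u)
  have ec1 : clusterInEvent ends t {W : Set V | b ∈ W} ∩ (connEvent ends s t)ᶜ ∩
      connEvent ends s u =
      connEvent ends s u ∩ clusterInEvent ends t {W : Set V | b ∈ W} ∩ (connEvent ends s t)ᶜ := by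
    ext ω; simp only [Set.mem_inter_iff]; tauto
  have ec2 : clusterInEvent ends t {W : Set V | b ∈ W} ∩ (connEvent ends s t)ᶜ ∩
      (connEvent ends s u)ᶜ =
      clusterInEvent ends t {W : Set V | b ∈ W} ∩
      ((connEvent ends s t)ᶜ ∩ (connEvent ends s u)ᶜ) :=
    Set.inter_assoc _ _ _
  rw [ec1, ec2] at sc
  have sd := prob_inter_add_prob_inter_compl p (connEvent ends s t)ᶜ (connEvent ends s u)
  have ed1 : (connEvent ends s t)ᶜ ∩ connEvent ends s u =
      connEvent ends s u ∩ (connEvent ends s t)ᶜ := Set.inter_comm _ _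
  rw [ed1] at sd
  have sf := prob_inter_add_prob_inter_compl p (connEvent ends s t)ᶜ
    (clusterInEvent ends s {W : Set V | o ∈ W})
  have ef1 : (connEvent ends s t)ᶜ ∩ clusterInEvent ends s {W : Set V | o ∈ W} =
      clusterInEvent ends s {W : Set V | o ∈ W} ∩ (connEvent ends s t)ᶜ := Set.inter_comm _ _
  have ef2 : (connEvent ends s t)ᶜ ∩ (clusterInEvent ends s {W : Set V | o ∈ W})ᶜ =
      (clusterInEvent ends s {W : Set V | o ∈ W})ᶜ ∩ (connEvent ends s t)ᶜ := Set.inter_comm _ _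
  rw [ef1, ef2] at sf
  exact sameSide_drop_algebra sa.symm sb.symm sc.symm sd.symm sf.symm main

end AvoidWeighted

end Summit.Ventures.PercRepro2
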